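import Summits.BirchSwinnertonDyer.BirchSwinnertonDyer.Theorems.BiquadraticEisensteinDescentEisensteinHeartFlatCMInertBadKPrimeTiedFrame
import HarnessLib

set_option linter.dupNamespace false -- `Summit.BirchSwinnertonDyer.BirchSwinnertonDyer.Theorems.…` (summit = sub)
set_option autoImplicit false

/-!
# Crux `InertBadAtThree` (stmt-BirchSwinnertonDyer-19225), line `rubin_e1_inert_three` v7 — the TIED KATZ LINE FRAME at a given quadratic
# `L ⊇ K′` AT EVERY ODD PRIME (the `p ≠ 2` form of BED's `…TiedFrame.exists_tiedFrame_of_frame`, p625325)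

Lead-prover seat `bsd-line-ibd-p1` g8 (cell `pub/bsd-wall`, LINE mode on crux 19225). The v7 skeleton of the line of record
(`Cruxes/InertBadAtThree/Lines/rubin_e1_inert_three.lean`, sha16 f6b89b5b26dffca7) carries the registered stub `stub_tiedKatzFrameAtThree` =
BED's `stub_V2` (crux stmt-21341, line `hsieh_lambda` v3) with `5 ≤ p` replaced by `p = 3`. BED's conditional closer of `stub_V2`
(`…StubV2AllJ.stub_V2_of_katz_of_deuring`, p625968) rests on `…TiedFrame.exists_tiedFrame_of_frame` (bsd-wall-cm-bed-w3 g7, p625325), whose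
hypothesis `hp5 : 5 ≤ p` is used ONLY as `p ≠ 2` (`not_isSquare_of_cmInert`, `ZpExtension.surjective_comp_absGaloisRestrict_of_finrank_eq_two`)
and `2 < p` (the Katz existence one-call `KatzCM.exists_isBaseChangeLine'`). THIS FILE records that theorem at its natural generality
`p ≠ 2` (`exists_tiedFrame_of_frame_of_ne_two`, statement otherwise identical, proof VERBATIM; the §1 frame lemmas of p625325 are used by
name, not restated), so that the `p = 3` conditional closer of `stub_tiedKatzFrameAtThree` (companion file `…InertBadAtThreeHeartStubV2`)
is the same one-call as at `p ≥ 5`.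

THEOREMS ONLY (no definition, no named fact, no `sorry`); CONDITIONAL on the Katz–Hida–Tilouine existence fact
`hsieh2014mu_prop49_exists_isMeasure` BY NAME (a hypothesis); nothing about V4K@3 (the line's input), about Deuring's theorem or about any
case of BSD is asserted. Supports, does not close, stmt-BirchSwinnertonDyer-19225. BSD is not proved by any of this.

References: [Hsieh2014mu] Prop. 4.9 (§4.8), §3.1 (d1)(d2), §4.1; [SilvermanATAEC1994] Ch. II Thm. 9.2, 10.5 (b); [Washington1997]
§13.1–13.2; [NeukirchANT1999] Ch. IV §1; [TateThesis1967] §4.3.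
-/

noncomputable section

open scoped Classical NumberField IntermediateField
open NumberField IsDedekindDomain Module CongruenceSubgroup WeierstrassCurve IntermediateField
open Literature.NumberTheory.EllipticCurves Literature.NumberTheory.GaloisRepresentations
open Literature.NumberTheory.EllipticCurves.ModularForms Literature.NumberTheory.EllipticCurves.Rank1Residual


namespace Summit.BirchSwinnertonDyer.BirchSwinnertonDyer.Theorems.InertBadSignedBranchesInertBadAtThreeHeartTiedFrame

open Summit.BirchSwinnertonDyer.BirchSwinnertonDyer.Theorems.BiquadraticEisensteinDescentEisensteinHeartFlatCMInertBadKPrimeKatzHsiehLValueCM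
  (hLval_of_deuring_of_cmField)
open Summit.BirchSwinnertonDyer.BirchSwinnertonDyer.Theorems.BiquadraticEisensteinDescentEisensteinHeartFlatCMInertBadKPrimeKatzTypeAtFrame
  (exists_hT_hcont_adjoin)
open Summit.BirchSwinnertonDyer.BirchSwinnertonDyer.Theorems.BiquadraticEisensteinDescentEisensteinHeartFlatCMInertBadKPrimeFrameCMSubfield
  (not_mem_range_rat finrank_adjoin_eq_two isCMFieldOfJ_adjoin isTotallyComplex_adjoin finrank_adjoin_top_eq_two
    isGalois_adjoin_top isGalois_adjoin exists_ne_one restrictNormal_ne_one)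
open Summit.BirchSwinnertonDyer.BirchSwinnertonDyer.Theorems.BiquadraticEisensteinDescentEisensteinHeartFlatCMInertBadKPrimeThetaRoute
  (not_dvd_discr_of_heegner)
open Summit.BirchSwinnertonDyer.BirchSwinnertonDyer.Theorems.BiquadraticEisensteinDescentEisensteinHeartFlatCMInertBadKPrimeThetaRouteIm
  (exists_theta_datum_route_im)
open Summit.BirchSwinnertonDyer.BirchSwinnertonDyer.Theorems.BiquadraticEisensteinDescentEisensteinHeartFlatCMInertBadKPrimeBiquadraticCMField
  (isTotallyComplex_of_tower finrank_eq_four)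
open Summit.BirchSwinnertonDyer.BirchSwinnertonDyer.Theorems.BiquadraticEisensteinDescentEisensteinHeartFlatCMInertBadKPrimeBiquadraticPrimes
  (not_isSquare_of_cmInert not_exists_sq_eq_of_split sqrt_not_mem_range)
open Summit.BirchSwinnertonDyer.BirchSwinnertonDyer.Theorems.BiquadraticEisensteinDescentEisensteinHeartFlatCMInertBadKPrimeBiquadraticCMType
  (katz_frame_primes isCMField_of_split)
open Summit.BirchSwinnertonDyer.BirchSwinnertonDyer.Theorems.BiquadraticEisensteinDescentEisensteinHeartFlatCMInertBadKPrimeSigmaOrientation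
  (inSigma_singleton_iff)
open Summit.BirchSwinnertonDyer.BirchSwinnertonDyer.Theorems.BiquadraticEisensteinDescentEisensteinHeartFlatCMInertBadKPrimeBiquadraticExists
  (isGalois_of_finrank_eq_two)
open Summit.BirchSwinnertonDyer.BirchSwinnertonDyer.Theorems.BiquadraticEisensteinDescentEisensteinHeartFlatCMInertBadKPrimeCuspCoeffVanishing
  (cuspCoeff_eq_zero_of_hasCM_of_not_good dvd_conductorNorm_of_not_good)
open Summit.BirchSwinnertonDyer.BirchSwinnertonDyer.Theorems.BiquadraticEisensteinDescentEisensteinHeartFlatCMInertBadKPrimeTiedFrame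
  (adjoin_eq_top_of_not_mem_range normCharacter_apply_eq_cpow_one restrictNormal_eq_of_ne_one)

variable {K : Type} [Field K] [NumberField K] {L : Type} [Field L] [NumberField L] [Algebra K L]

/-- **THE TIED KATZ LINE FRAME AT A GIVEN QUADRATIC `L ⊇ K′`, every odd `p`** — `…TiedFrame.exists_tiedFrame_of_frame` (p625325) with
`hp5 : 5 ≤ p` weakened to `hp2 : p ≠ 2`, statement otherwise identical, proof VERBATIM (`2 < p` for the Katz one-call from `p` prime `≠ 2`).
Inputs: the item's binders (`W/ℚ` CM, `p` odd CM-inert and bad, `K = K′` imaginary quadratic Heegner for `N_W`, `κ, γ`, `𝔭 ≠ 𝔭′ ∋ p`, `f`,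
`ι`); the Katz existence fact BY NAME; a quadratic `L ⊇ K′` with `x² = cmFieldDiscrOfJ W.j`; a Hecke character `ψ` of `ℚ⟮x⟯` of type `(1,0)`
with Deuring (iv) for `W` relative to `c ≠ 1` and `ψ ∘ N` ramified above the bad primes; `θ₀, a`; the (R)/S bookkeeping. Output: `𝔓′ ∣ 𝔭′`,
`T ⊆ S`, `ϑ`, a Katz frame `(C_K, Ω, Ω′_p, G)` with `KatzCM.IsBaseChangeLine ι {𝔓′} S T κ γ λ ϑ C_K Ω Ω′_p G`, the places `w₁ ≠ w₂`, and
(T), (C), (L), (R), non-vanishing — every conjunct of `stub_tiedKatzFrameAtThree` / `stub_V2`. [cite: Hsieh2014mu, Prop. 4.9 (§4.8), §3.1, §4.1]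
[cite: SilvermanATAEC1994, Ch. II Thm. 10.5 (b)] [cite: Washington1997, §13.1–13.2] -/
theorem exists_tiedFrame_of_frame_of_ne_two
    -- the item's binders
    (W : WeierstrassCurve ℚ) [W.IsElliptic] [W.IsGloballyMinimal] [NeZero (W.conductorNorm ℤ)]
    {p : ℕ} [Fact p.Prime] (hCM : W.HasCM) (hp2 : p ≠ 2) (hin : CMInert W p)
    (hbad : ¬ Good W p) (hK : IsImaginaryQuadratic K) (hHN : SatisfiesHeegnerHypothesis (W.conductorNorm ℤ) K)
    (κ : ZpExtension K p) {γ : Field.absoluteGaloisGroup K} (hγ : κ.IsTopGenerator γ)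
    {𝔭 𝔭' : HeightOneSpectrum (𝓞 K)} (h𝔭 : ((p : ℕ) : 𝓞 K) ∈ 𝔭.asIdeal) (h𝔭' : ((p : ℕ) : 𝓞 K) ∈ 𝔭'.asIdeal)
    (hne : 𝔭' ≠ 𝔭) {f : CuspForm (Gamma0 (W.conductorNorm ℤ)) 2} (hf : IsNewformOf W f) {ι : PadicAlgCl p ≃+* ℂ}
    (hι : ∀ (w : InfinitePlace K) (k : 𝓞 K), k ∈ 𝔭.asIdeal ↔ ‖ι.symm (w.embedding (k : K))‖ < 1)
    -- the Katz–Hida–Tilouine existence fact, by name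
    (hKatz : hsieh2014mu_prop49_exists_isMeasure)
    -- the frame `L = K′(x)`, `x² = d_CM` (Galois instances: `…BiquadraticExists.isGalois_of_finrank_eq_two`,
    -- `…FrameCMSubfield.isGalois_adjoin_top`)
    [IsGalois K L] (h2 : finrank K L = 2) {x : L} (hx : x ^ 2 = (cmFieldDiscrOfJ W.j : L)) [IsGalois ℚ⟮x⟯ L]
    -- a Hecke character of the CM field realised as `ℚ⟮x⟯ ⊆ L`: type `(1,0)`, Deuring (iv) for `W`, ramified above bad primes
    (c : ℚ⟮x⟯ ≃ₐ[ℚ] ℚ⟮x⟯) (hc : c ≠ 1) {ψ : HeckeCharacter ℚ⟮x⟯}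
    (hψ1 : ψ.HasInfinityType (fun _ ↦ 1) (fun _ ↦ 0))
    (hψ4 : ∀ (ℓ : ℕ) [Fact ℓ.Prime], W.HasGoodReductionAtPrime ℓ →
      ∀ 𝔮 : HeightOneSpectrum (𝓞 ℚ⟮x⟯), (ℓ : 𝓞 ℚ⟮x⟯) ∈ 𝔮.asIdeal →
        ψ.IsUnramifiedAt 𝔮 ∧
        (c • 𝔮 ≠ 𝔮 →
          ψ.valueAtUniformizer 𝔮 + ψ.valueAtUniformizer (c • 𝔮) = (W.frobeniusTrace ℓ : ℂ) ∧
          ψ.valueAtUniformizer 𝔮 * ψ.valueAtUniformizer (c • 𝔮) = (ℓ : ℂ)) ∧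
        (c • 𝔮 = 𝔮 → W.frobeniusTrace ℓ = 0 ∧ ψ.valueAtUniformizer 𝔮 = -(ℓ : ℂ)))
    (hψbad : ∀ (ℓ : ℕ) [Fact ℓ.Prime], ¬ W.HasGoodReductionAtPrime ℓ →
      ∀ w : HeightOneSpectrum (𝓞 L), (ℓ : 𝓞 L) ∈ w.asIdeal → ¬ (ψ.compRelNorm L).IsUnramifiedAt w)
    -- the CM-field element of `…KatzHsiehLValueCM` (`…CMFieldTheta.exists_theta_datum`)
    (θ₀ : 𝓞 ℚ⟮x⟯) (a : ℤ) (hcθ : c • θ₀ = (a : 𝓞 ℚ⟮x⟯) - θ₀)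
    (hθ : ∀ 𝔮 : HeightOneSpectrum (𝓞 ℚ⟮x⟯), Ideal.absNorm 𝔮.asIdeal = (Ideal.absNorm 𝔮.asIdeal).minFac ^ 2 →
      (a : 𝓞 ℚ⟮x⟯) - 2 * θ₀ ∉ 𝔮.asIdeal)
    (hθram : ∀ (ℓ : ℕ) [Fact ℓ.Prime] (𝔮 : HeightOneSpectrum (𝓞 ℚ⟮x⟯)), (ℓ : 𝓞 ℚ⟮x⟯) ∈ 𝔮.asIdeal →
      (a : 𝓞 ℚ⟮x⟯) - 2 * θ₀ ∈ 𝔮.asIdeal → ¬ W.HasGoodReductionAtPrime ℓ)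
    -- the (R)/S bookkeeping on `S` = primes of `L` above the bad `ℓ ≠ p` (`…KatzFrameBookkeeping`)
    (S : Finset (HeightOneSpectrum (𝓞 L)))
    (hSP : ∀ w ∈ S, ∃ ℓ ∈ (W.conductorNorm ℤ).primeFactors, ((ℓ : ℕ) : 𝓞 L) ∈ w.asIdeal)
    (hS : ∀ w ∈ S, ((p : ℕ) : 𝓞 L) ∉ w.asIdeal)
    (hlam : ∀ w : HeightOneSpectrum (𝓞 L), w ∉ S → ((p : ℕ) : 𝓞 L) ∉ w.asIdeal →
      (ψ.compRelNorm L * HeckeCharacter.normCharacter L).IsUnramifiedAt w)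
    (hramS : ∀ w ∈ S ∪ KatzCM.primesOver L p, ¬ (ψ.compRelNorm L * HeckeCharacter.normCharacter L).IsUnramifiedAt w) :
    ∃ (𝔓' : HeightOneSpectrum (𝓞 L)) (T : Finset (HeightOneSpectrum (𝓞 L))) (ϑ : L) (CK : ℂ)
      (Ω : InfinitePlace L → ℂ) (ΩpK : InfinitePlace L → ℂ_[p]) (G : PowerSeries 𝓞_ℂ_[p]) (w₁ w₂ : InfinitePlace L),
      𝔓'.asIdeal.LiesOver 𝔭'.asIdeal ∧ T ⊆ S ∧
      w₁ ≠ w₂ ∧ (∀ w : InfinitePlace L, w = w₁ ∨ w = w₂) ∧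
      (∀ (χ : HeckeCharacter K) (n : ℕ), 0 < n → (∀ v : HeightOneSpectrum (𝓞 K), χ.IsUnramifiedAt v) →
        χ.HasInfinityType (fun _ ↦ (n : ℤ)) (fun _ ↦ -(n : ℤ)) →
        KatzCM.HasKatzType ι ({𝔓'} : Finset (HeightOneSpectrum (𝓞 L)))
          (ψ.compRelNorm L * HeckeCharacter.normCharacter L * χ.compRelNorm L) 1
          (fun w ↦ if w = w₁ then n else n - 1)) ∧
      (∀ (χ : HeckeCharacter K) (n : ℕ), 0 < n → (∀ v : HeightOneSpectrum (𝓞 K), χ.IsUnramifiedAt v) →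
        χ.HasInfinityType (fun _ ↦ (n : ℤ)) (fun _ ↦ -(n : ℤ)) →
        LFunction.HasEntireContinuation
          (heckeLFunction (ψ.compRelNorm L * HeckeCharacter.normCharacter L * χ.compRelNorm L))) ∧
      (1 : ℂ) ≠ 0 ∧ (1 : ℂ) ≠ 0 ∧
      (∀ (χ : HeckeCharacter K) (n : ℕ), 0 < n → (∀ v : HeightOneSpectrum (𝓞 K), χ.IsUnramifiedAt v) →
        χ.HasInfinityType (fun _ ↦ (n : ℤ)) (fun _ ↦ -(n : ℤ)) →
        ∀ hL : LFunction.HasEntireContinuation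
            (heckeLFunction (ψ.compRelNorm L * HeckeCharacter.normCharacter L * χ.compRelNorm L)),
          hL.continuation 0 = 1 * 1 ^ n * rankinSelbergValueHecke f χ 1) ∧
      (∀ w ∈ S ∪ KatzCM.primesOver L p, ¬ (ψ.compRelNorm L * HeckeCharacter.normCharacter L).IsUnramifiedAt w) ∧
      (∀ w ∈ ({𝔓'} : Finset (HeightOneSpectrum (𝓞 L))) ∪ T,
        ¬ (ψ.compRelNorm L * HeckeCharacter.normCharacter L).IsUnramifiedAt w) ∧
      CK ≠ 0 ∧ (∀ w, Ω w ≠ 0) ∧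
      (∀ w, (KatzCM.embeddingAt ι ({𝔓'} : Finset (HeightOneSpectrum (𝓞 L))) w ϑ).im ≠ 0) ∧ (∀ w, ΩpK w ≠ 0) ∧
      KatzCM.IsBaseChangeLine ι ({𝔓'} : Finset (HeightOneSpectrum (𝓞 L))) S T κ γ
        (ψ.compRelNorm L * HeckeCharacter.normCharacter L) ϑ CK Ω ΩpK G := by
  have hp : p.Prime := Fact.out
  have hp3 : 2 < p := lt_of_le_of_ne hp.two_le (Ne.symm hp2)
  have hne' : 𝔭 ≠ 𝔭' := fun h ↦ hne h.symm
  -- arithmetic of the frame (`d := cmFieldDiscrOfJ W.j`)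
  have hd : ¬ IsSquare ((cmFieldDiscrOfJ W.j : ℤ) : ZMod p) := not_isSquare_of_cmInert hp2 hin
  have hd0 : cmFieldDiscrOfJ W.j < 0 := by
    rcases Summit.BirchSwinnertonDyer.BirchSwinnertonDyer.Theorems.BiquadraticEisensteinDescentEisensteinHeartFlatCMInertBadKPrimeThetaRoute.cmFieldDiscrOfJ_mem_nine
        W hCM with h | h | h | h | h | h | h | h | h <;> rw [h] <;> norm_num
  haveI : FiniteDimensional K L := Module.Finite.of_restrictScalars_finite ℚ K L
  have hxK : x ∉ Set.range (algebraMap K L) := sqrt_not_mem_range (not_exists_sq_eq_of_split hK.1 hd h𝔭 h𝔭' hne') hx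
  have hxQ : x ∉ Set.range (algebraMap ℚ L) := not_mem_range_rat hxK
  haveI : IsCMField K := hK.isCMField
  haveI : IsCMField L := isCMField_of_split hK h2 hd0 hd hx h𝔭 h𝔭' hne'
  haveI : IsTotallyComplex K := hK.2
  haveI : IsTotallyComplex L := isTotallyComplex_of_tower (K := K)
  haveI : IsGalois ℚ ℚ⟮x⟯ := isGalois_adjoin hx hxQ
  haveI : IsTotallyComplex ℚ⟮x⟯ := isTotallyComplex_adjoin hx hd0
  have h4 : finrank ℚ L = 4 := finrank_eq_four hK h2
  have h2K₁ : finrank ℚ ℚ⟮x⟯ = 2 := finrank_adjoin_eq_two hx hxQ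
  have h2L₁ : finrank ℚ⟮x⟯ L = 2 := finrank_adjoin_top_eq_two hK h2 hx hxQ
  -- the primes above `p` in `L`; `Σ_p = {𝔓′}`; `p ∤ d_{L⁺}`
  obtain ⟨𝔓, 𝔓', h𝔓, h𝔓', hPP, hprimes, -, -, -, hSp', -, hunrL⟩ :=
    katz_frame_primes (p := p) hK h2 hd hx h𝔭 h𝔭' hne'
  haveI := h𝔓
  haveI := h𝔓'
  obtain ⟨xo, hxo, hxo2⟩ :=
    Summit.BirchSwinnertonDyer.BirchSwinnertonDyer.Theorems.BiquadraticEisensteinDescentEisensteinHeartFlatCMInertBadKPrimeBiquadraticPrimes.exists_ringOfIntegers_sq_eq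
      hx
  -- orientation of `Σ` by the `𝔭`-compatible embedding `φ₀`
  obtain ⟨v₀⟩ : Nonempty (InfinitePlace K) := inferInstance
  have hι₀ : ∀ k : 𝓞 K, k ∈ 𝔭.asIdeal ↔ ‖ι.symm (v₀.embedding (k : K))‖ < 1 := fun k ↦ hι v₀ k
  have hSig : ∀ σ : L →+* ℂ, KatzCM.InSigma ι ({𝔓'} : Finset (HeightOneSpectrum (𝓞 L))) σ ↔
      σ.comp (algebraMap K L) = ComplexEmbedding.conjugate v₀.embedding :=
    fun σ ↦ inSigma_singleton_iff (𝔓 := 𝔓) (𝔓' := 𝔓') hK h4 hd hxo2 h𝔭 h𝔭' hne' hι₀ σ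
  -- (T) and (C)
  obtain ⟨w₁, w₂, hw, huniv, hT, hcont⟩ := exists_hT_hcont_adjoin hK h2 hx hd0 hxK hSp' hSig hψ1
  -- the conjugation datum
  obtain ⟨τ, hτ⟩ := exists_ne_one (K := K) (L := L) h2
  have hτc : (τ.restrictScalars ℚ).restrictNormal ℚ⟮x⟯ = c := restrictNormal_eq_of_ne_one h2 hx hxK τ hτ c hc
  -- (L)
  have hLval := hLval_of_deuring_of_cmField (K := K) (L := L) (ι := ι) hSp' W hCM c hψ1 hψ4 hψbad hf h2K₁ hK.1 h2
    h2L₁ hτ hτc θ₀ a hcθ hθ hθram (ν := HeckeCharacter.normCharacter L) normCharacter_apply_eq_cpow_one hT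
  -- Hsieh's `ϑ`, the sets `D`, `T`, and the non-vanishing `Im σ(ϑ) ≠ 0`
  have hgen : Algebra.adjoin K {x} = ⊤ := adjoin_eq_top_of_not_mem_range h2 hxK
  obtain ⟨ϑ, D, T, hϑ₁, hϑ₂, hIm, hTS, hTc, hST, hD₁, hD₂, hD₃, hD₄, hd2⟩ :=
    exists_theta_datum_route_im W p K hCM hbad hK hHN L h2.le hgen hx v₀.embedding (ι := ι)
      (Sp := ({𝔓'} : Finset (HeightOneSpectrum (𝓞 L)))) (fun σ hσ ↦ (hSig σ).mp hσ) S hSP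
  -- (R) on `Σ_p ∪ T`
  have hramT : ∀ w ∈ ({𝔓'} : Finset (HeightOneSpectrum (𝓞 L))) ∪ T,
      ¬ (ψ.compRelNorm L * HeckeCharacter.normCharacter L).IsUnramifiedAt w := by
    intro w hw
    rcases Finset.mem_union.mp hw with h | h
    · rw [Finset.mem_singleton] at h
      subst h
      exact hramS _ (Finset.mem_union_right _ (by rw [hprimes]; simp))
    · exact hramS _ (Finset.mem_union_left _ (hTS h))
  -- the restricted `ℤ_p`-extension and the KATZ LINE FRAME (V1 existence, granted the named fact)
  have hs := ZpExtension.surjective_comp_absGaloisRestrict_of_finrank_eq_two hp2 κ L h2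
  obtain ⟨γL, hγL⟩ := ZpExtension.exists_isTopGenerator_restrict κ L hs
  obtain ⟨CK, Ω, ΩpK, G, hCK, hΩ, hΩpK, hG⟩ :=
    KatzCM.exists_isBaseChangeLine' (S := S) (T := T) hKatz hp3 hunrL hSp' hϑ₁ hϑ₂ hS hTS hTc hST hD₁ hD₂ hD₃
      hD₄ hd2 hlam hs hγ hγL
  have hΩpK0 : ∀ w, ΩpK w ≠ 0 := fun w h ↦ by
    have h1 := hΩpK w
    rw [h, norm_zero] at h1
    exact zero_ne_one h1
  exact ⟨𝔓', T, ϑ, CK, Ω, ΩpK, G, w₁, w₂, h𝔓', hTS, hw, huniv, hT, hcont, one_ne_zero, one_ne_zero, hLval, hramS,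
    hramT, hCK, hΩ, fun w ↦ hIm _, hΩpK0, hG⟩

end Summit.BirchSwinnertonDyer.BirchSwinnertonDyer.Theorems.InertBadSignedBranchesInertBadAtThreeHeartTiedFrame

end
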